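import Mathlib
import Summits.CriticalPhenomena.Ising3DConformalLimit.Theses.PrimaryAtInfinity
import Summits.CriticalPhenomena.Ising3DConformalLimit.Theorems.PrimaryAtInfinityMultipoleToWardHelpers

/-!
# Route PrimaryAtInfinity · item `MultipoleToWard` — the two sides of the tested identity

Bookkeeping and the two estimates behind the proof of
`Summit.CriticalPhenomena.Ising3DConformalLimit.Theses.PrimaryAtInfinity.MultipoleToWard`
(file `PrimaryAtInfinityMultipoleToWard.lean`).

* First-order expressions `x ↦ a(x) f(x) + Df(x)[V(x)]` of a test function `f` (the shape of the
  adjoint special-conformal operator `𝒦†_b`): they vanish off `tsupport f`, are continuous for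
  smooth `f`, have compact support inside `tsupport f`; the derivative of an even function is
  odd; dilations `z ↦ f (L⁻¹ • z)` preserve compact support and push supports outwards;
  products `(y, z) ↦ f y * g z` have the expected (topological) supports.
* The weak first-multipole identity `∫ ⟪A₁, b⟫ ψ = ∫ A₀ 𝒦†_b ψ`, tested with
  `ψ(x, z) = φ(x) χ_L(z)` and transferred to the product `ℝ³ × (Fin n → ℝ³)`, has a
  **dipole side** `∫∫ ⟪A₁(x,z), b⟫ φ(x) χ_L(z) = O(ε ‖χ_L‖₁ ‖φ‖₁)` once
  `A₁(x,z) = 2Δc Sₙ(x) z + (≤ ε)` on the support (the explicit dipole term dies because `χ_L` is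
  even) — `dipole_side_bound`; and a **monopole side**
  `∫∫ A₀(x,z) [χ_L(z) 𝒦†φ(x) + φ(x) G_L(z)]`
  `= c (∫χ_L) ∫ Sₙ 𝒦†φ + O((ε/L)(‖χ_L‖₁‖𝒦†φ‖₁ + ‖G_L‖₁‖φ‖₁))`
  once `A₀(x,z) = c Sₙ(x) + (≤ ε/‖z‖)` on the support and `∫ G_L = 0` — `monopole_side_bound`.

Elementary real analysis (Fubini for product integrands, dominated bounds); THEOREM-ONLY file.
Sources: Hörmander, *ALPDO I*, §1; Di Francesco–Mathieu–Sénéchal 1997 §4.2–4.3. [folklore]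
-/

noncomputable section

namespace Summit.CriticalPhenomena.Ising3DConformalLimit.Theorems.PrimaryAtInfinityMultipoleToWard

open MeasureTheory Filter Set Function Metric Literature.Probability.LatticeModels
open scoped Topology

/-! ### First-order expressions `a • f + ∂_V f` of a test function -/

section FirstOrder

variable {X : Type*} [NormedAddCommGroup X] [NormedSpace ℝ X]

/-- Off the topological support of `f`, `a f(x) + Df(x)[v] = 0`. [folklore] -/
theorem firstOrder_apply_eq_zero {f : X → ℝ} {x : X} (hx : x ∉ tsupport f) (a : ℝ) (v : X) :
    a * f x + fderiv ℝ f x v = 0 := by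
  rw [image_eq_zero_of_notMem_tsupport hx, fderiv_of_notMem_tsupport ℝ hx]
  simp

/-- `x ↦ a(x) f(x) + Df(x)[V(x)]` is continuous for smooth `f` and continuous `a`, `V`.
[folklore] -/
theorem continuous_firstOrder {f : X → ℝ} {a : X → ℝ} {V : X → X}
    (hf : ContDiff ℝ ((⊤ : ℕ∞) : WithTop ℕ∞) f) (ha : Continuous a) (hV : Continuous V) :
    Continuous fun x => a x * f x + fderiv ℝ f x (V x) :=
  (ha.mul hf.continuous).add ((hf.continuous_fderiv (by simp)).clm_apply hV)

/-- `x ↦ a(x) f(x) + Df(x)[V(x)]` has compact support if `f` has. [folklore] -/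
theorem hasCompactSupport_firstOrder {f : X → ℝ} (hf : HasCompactSupport f) (a : X → ℝ)
    (V : X → X) : HasCompactSupport fun x => a x * f x + fderiv ℝ f x (V x) :=
  HasCompactSupport.intro' hf (isClosed_tsupport f) fun _ hx => firstOrder_apply_eq_zero hx _ _

/-- The topological support of `x ↦ a(x) f(x) + Df(x)[V(x)]` lies in that of `f`. [folklore] -/
theorem tsupport_firstOrder_subset {f : X → ℝ} (a : X → ℝ) (V : X → X) :
    tsupport (fun x => a x * f x + fderiv ℝ f x (V x)) ⊆ tsupport f :=
  closure_minimal (fun _ hx => by_contra fun h => hx (firstOrder_apply_eq_zero h _ _))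
    (isClosed_tsupport f)

/-- The derivative of an even function is odd. [folklore] -/
theorem fderiv_neg_of_even {f : X → ℝ} (hf : ∀ x, f (-x) = f x) (x : X) :
    fderiv ℝ f (-x) = -fderiv ℝ f x := by
  have h := fderiv_comp_smul (f := f) (x := -x) (-1 : ℝ)
  simp only [neg_smul, one_smul, hf, neg_neg] at h
  rw [h]

/-- Compact support is preserved by the dilation `z ↦ f (L⁻¹ • z)`, `L > 0`. [folklore] -/
theorem hasCompactSupport_comp_inv_smul [ProperSpace X] {f : X → ℝ} (hf : HasCompactSupport f)
    {L : ℝ} (hL : 0 < L) : HasCompactSupport fun z => f (L⁻¹ • z) := by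
  obtain ⟨R, hR⟩ := hf.isCompact.isBounded.subset_closedBall 0
  refine HasCompactSupport.intro (isCompact_closedBall (0 : X) (L * R)) fun z hz => ?_
  apply image_eq_zero_of_notMem_tsupport
  intro h
  have h1 := hR h
  rw [mem_closedBall, dist_zero_right, norm_smul, norm_inv, Real.norm_of_nonneg hL.le,
    inv_mul_le_iff₀ hL] at h1
  exact hz (by rwa [mem_closedBall, dist_zero_right])

/-- If `tsupport f ⊆ {ρ ≤ ‖u‖}` then `tsupport (f (L⁻¹ • ·)) ⊆ {L ρ ≤ ‖z‖}` (`L > 0`).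
[folklore] -/
theorem tsupport_comp_inv_smul_subset {f : X → ℝ} {ρ L : ℝ} (hL : 0 < L)
    (hf : tsupport f ⊆ {u | ρ ≤ ‖u‖}) :
    tsupport (fun z => f (L⁻¹ • z)) ⊆ {z | L * ρ ≤ ‖z‖} := by
  refine closure_minimal (fun z hz => ?_) (isClosed_le continuous_const continuous_norm)
  have h1 : ρ ≤ ‖L⁻¹ • z‖ := hf (subset_tsupport _ hz)
  rw [norm_smul, norm_inv, Real.norm_of_nonneg hL.le] at h1
  rw [mem_setOf_eq]
  rwa [le_inv_mul_iff₀ hL] at h1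

end FirstOrder

/-! ### Products on `Y × Z` -/

/-- Compact support of `(y, z) ↦ f y * g z`. [folklore] -/
theorem hasCompactSupport_fst_mul_snd {Y Z : Type*} [TopologicalSpace Y] [TopologicalSpace Z]
    {f : Y → ℝ} {g : Z → ℝ} (hf : HasCompactSupport f) (hg : HasCompactSupport g) :
    HasCompactSupport fun p : Y × Z => f p.1 * g p.2 := by
  refine HasCompactSupport.intro' (hf.isCompact.prod hg.isCompact)
    ((isClosed_tsupport f).prod (isClosed_tsupport g)) ?_
  rintro ⟨y, z⟩ hyz
  rcases not_and_or.1 (fun h => hyz (mk_mem_prod h.1 h.2)) with h | h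
  · simp [image_eq_zero_of_notMem_tsupport h]
  · simp [image_eq_zero_of_notMem_tsupport h]

/-- The topological support of `(y, z) ↦ f y * g z` lies in `tsupport f ×ˢ tsupport g`.
[folklore] -/
theorem tsupport_fst_mul_snd_subset {Y Z : Type*} [TopologicalSpace Y] [TopologicalSpace Z]
    (f : Y → ℝ) (g : Z → ℝ) :
    tsupport (fun p : Y × Z => f p.1 * g p.2) ⊆ tsupport f ×ˢ tsupport g := by
  refine closure_minimal (fun p hp => ?_) ((isClosed_tsupport f).prod (isClosed_tsupport g))
  rw [mem_support, mul_ne_zero_iff] at hp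
  exact ⟨subset_tsupport _ hp.1, subset_tsupport _ hp.2⟩

/-! ### The two sides of the tested first-multipole identity -/

/-- **Dipole side.** With the cut-off `χL` supported in `{L ≤ ‖z‖}` and even, the dipole side
`∫∫ ⟪A₁(x,z), b⟫ φ(x) χL(z)` of the tested identity is small: the explicit part
`2Δc (∫ ⟪z,b⟫ χL)(∫ Sₙ φ)` vanishes by oddness and the remainder is bounded by
`ε ‖b‖ ‖χL‖₁ ‖φ‖₁` once `‖A₁(x,z) - 2Δc Sₙ(x) z‖ ≤ ε` for `‖z‖ ≥ L`, `x ∈ tsupport φ`. [folklore] -/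
theorem dipole_side_bound {n : ℕ} {Sn : (Fin n → EuclideanSpace ℝ (Fin 3)) → ℝ}
    {A₁ : (Fin (n + 1) → EuclideanSpace ℝ (Fin 3)) → EuclideanSpace ℝ (Fin 3)}
    {c Δ ε L : ℝ} {b : EuclideanSpace ℝ (Fin 3)} {φ : (Fin n → EuclideanSpace ℝ (Fin 3)) → ℝ}
    {χL : EuclideanSpace ℝ (Fin 3) → ℝ}
    (hSn : ContinuousOn Sn (NonCoincident 3 n))
    (hA₁ : ContinuousOn (fun w => inner ℝ (A₁ w) b) (NonCoincident 3 (n + 1)))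
    (hφ : Continuous φ) (hφc : HasCompactSupport φ) (hφs : tsupport φ ⊆ NonCoincident 3 n)
    (hχ : Continuous χL) (hχc : HasCompactSupport χL) (hχe : ∀ z, χL (-z) = χL z)
    (hχt : tsupport χL ⊆ {z | L ≤ ‖z‖})
    (hgood : ∀ z : EuclideanSpace ℝ (Fin 3), L ≤ ‖z‖ → ∀ x ∈ tsupport φ,
      (Fin.snoc x z : Fin (n + 1) → EuclideanSpace ℝ (Fin 3)) ∈ NonCoincident 3 (n + 1))
    (hR : ∀ z : EuclideanSpace ℝ (Fin 3), L ≤ ‖z‖ → ∀ x ∈ tsupport φ,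
      ‖A₁ (Fin.snoc x z) - (2 * Δ * c * Sn x) • z‖ ≤ ε) :
    |∫ p : EuclideanSpace ℝ (Fin 3) × (Fin n → EuclideanSpace ℝ (Fin 3)),
        inner ℝ (A₁ (Fin.snoc p.2 p.1)) b * (φ p.2 * χL p.1)|
      ≤ ε * ‖b‖ * ((∫ z, |χL z|) * ∫ x, |φ x|) := by
  -- pointwise decomposition: explicit dipole + remainder
  have hpt : ∀ p : EuclideanSpace ℝ (Fin 3) × (Fin n → EuclideanSpace ℝ (Fin 3)),
      inner ℝ (A₁ (Fin.snoc p.2 p.1)) b * (φ p.2 * χL p.1)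
        = 2 * Δ * c * ((inner ℝ p.1 b * χL p.1) * (Sn p.2 * φ p.2))
          + inner ℝ (A₁ (Fin.snoc p.2 p.1) - (2 * Δ * c * Sn p.2) • p.1) b * (φ p.2 * χL p.1) := by
    intro p
    rw [inner_sub_left, real_inner_smul_left]
    ring
  -- integrability
  have hg : Continuous fun p : EuclideanSpace ℝ (Fin 3) × (Fin n → EuclideanSpace ℝ (Fin 3)) =>
      φ p.2 * χL p.1 := (hφ.comp continuous_snd).mul (hχ.comp continuous_fst)
  have hg' : (fun p : EuclideanSpace ℝ (Fin 3) × (Fin n → EuclideanSpace ℝ (Fin 3)) =>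
      φ p.2 * χL p.1) = fun p => χL p.1 * φ p.2 := funext fun p => mul_comm _ _
  have hgc : HasCompactSupport fun p :
      EuclideanSpace ℝ (Fin 3) × (Fin n → EuclideanSpace ℝ (Fin 3)) =>
      φ p.2 * χL p.1 := hg' ▸ hasCompactSupport_fst_mul_snd hχc hφc
  have hgt : tsupport (fun p : EuclideanSpace ℝ (Fin 3) × (Fin n → EuclideanSpace ℝ (Fin 3)) =>
      φ p.2 * χL p.1) ⊆ tsupport χL ×ˢ tsupport φ := hg' ▸ tsupport_fst_mul_snd_subset χL φ
  have hcont : ContinuousOn (fun p :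
      EuclideanSpace ℝ (Fin 3) × (Fin n → EuclideanSpace ℝ (Fin 3)) =>
      inner ℝ (A₁ (Fin.snoc p.2 p.1)) b) (tsupport χL ×ˢ tsupport φ) :=
    hA₁.comp continuous_snoc_prod.continuousOn fun p hp => hgood _ (hχt hp.1) _ hp.2
  have hfull : Integrable fun p : EuclideanSpace ℝ (Fin 3) × (Fin n → EuclideanSpace ℝ (Fin 3)) =>
      inner ℝ (A₁ (Fin.snoc p.2 p.1)) b * (φ p.2 * χL p.1) :=
    integrable_mul_of_continuousOn_tsupport hg hgc (hcont.mono hgt)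
  have hzb : Integrable fun z : EuclideanSpace ℝ (Fin 3) => inner ℝ z b * χL z :=
    ((continuous_id.inner continuous_const).mul hχ).integrable_of_hasCompactSupport hχc.mul_left
  have hSφ : Integrable fun x => Sn x * φ x :=
    integrable_mul_of_continuousOn_tsupport hφ hφc (hSn.mono hφs)
  have hmain : Integrable fun p : EuclideanSpace ℝ (Fin 3) × (Fin n → EuclideanSpace ℝ (Fin 3)) =>
      2 * Δ * c * ((inner ℝ p.1 b * χL p.1) * (Sn p.2 * φ p.2)) :=
    (integrable_fst_mul_snd hzb hSφ).const_mul _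
  have herr : Integrable fun p : EuclideanSpace ℝ (Fin 3) × (Fin n → EuclideanSpace ℝ (Fin 3)) =>
      inner ℝ (A₁ (Fin.snoc p.2 p.1) - (2 * Δ * c * Sn p.2) • p.1) b * (φ p.2 * χL p.1) := by
    have := hfull.sub hmain
    refine this.congr (ae_of_all _ fun p => ?_)
    simp only [Pi.sub_apply]
    rw [hpt p]
    ring
  -- the explicit dipole term vanishes by oddness
  have hodd : ∫ z : EuclideanSpace ℝ (Fin 3), inner ℝ z b * χL z = 0 :=
    integral_eq_zero_of_odd fun z => by rw [inner_neg_left, hχe, neg_mul]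
  -- pointwise bound on the remainder
  have hbd : ∀ p : EuclideanSpace ℝ (Fin 3) × (Fin n → EuclideanSpace ℝ (Fin 3)),
      ‖inner ℝ (A₁ (Fin.snoc p.2 p.1) - (2 * Δ * c * Sn p.2) • p.1) b * (φ p.2 * χL p.1)‖
        ≤ ε * ‖b‖ * (|χL p.1| * |φ p.2|) := by
    intro p
    rw [Real.norm_eq_abs, abs_mul, abs_mul]
    by_cases h0 : φ p.2 = 0 ∨ χL p.1 = 0
    · rcases h0 with h0 | h0 <;> simp [h0]
    push Not at h0
    have hx : p.2 ∈ tsupport φ := subset_tsupport _ h0.1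
    have hz : L ≤ ‖p.1‖ := hχt (subset_tsupport _ h0.2)
    have h1 : |inner ℝ (A₁ (Fin.snoc p.2 p.1) - (2 * Δ * c * Sn p.2) • p.1) b| ≤ ε * ‖b‖ :=
      (abs_real_inner_le_norm _ _).trans (mul_le_mul_of_nonneg_right (hR _ hz _ hx)
        (norm_nonneg _))
    calc |inner ℝ (A₁ (Fin.snoc p.2 p.1) - (2 * Δ * c * Sn p.2) • p.1) b| * (|φ p.2| * |χL p.1|)
        ≤ ε * ‖b‖ * (|φ p.2| * |χL p.1|) := by gcongr
      _ = ε * ‖b‖ * (|χL p.1| * |φ p.2|) := by ring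
  have hbdi : Integrable fun p : EuclideanSpace ℝ (Fin 3) × (Fin n → EuclideanSpace ℝ (Fin 3)) =>
      ε * ‖b‖ * (|χL p.1| * |φ p.2|) :=
    (integrable_fst_mul_snd (hχ.integrable_of_hasCompactSupport hχc).abs
      (hφ.integrable_of_hasCompactSupport hφc).abs).const_mul _
  -- assemble
  have hsplit : ∫ p : EuclideanSpace ℝ (Fin 3) × (Fin n → EuclideanSpace ℝ (Fin 3)),
      inner ℝ p.1 b * χL p.1 * (Sn p.2 * φ p.2) = (∫ z, inner ℝ z b * χL z) * ∫ x, Sn x * φ x :=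
    integral_fst_mul_snd (fun z => inner ℝ z b * χL z) (fun x => Sn x * φ x)
  have hsplit' : ∫ p : EuclideanSpace ℝ (Fin 3) × (Fin n → EuclideanSpace ℝ (Fin 3)),
      |χL p.1| * |φ p.2| = (∫ z, |χL z|) * ∫ x, |φ x| :=
    integral_fst_mul_snd (fun z => |χL z|) (fun x => |φ x|)
  rw [integral_congr_ae (ae_of_all _ hpt), integral_add hmain herr, integral_const_mul,
    hsplit, hodd, zero_mul, mul_zero, zero_add]
  calc |∫ p : EuclideanSpace ℝ (Fin 3) × (Fin n → EuclideanSpace ℝ (Fin 3)),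
          inner ℝ (A₁ (Fin.snoc p.2 p.1) - (2 * Δ * c * Sn p.2) • p.1) b * (φ p.2 * χL p.1)|
      ≤ ∫ p : EuclideanSpace ℝ (Fin 3) × (Fin n → EuclideanSpace ℝ (Fin 3)),
          ε * ‖b‖ * (|χL p.1| * |φ p.2|) := by
        rw [← Real.norm_eq_abs]
        exact norm_integral_le_of_norm_le hbdi (ae_of_all _ hbd)
    _ = ε * ‖b‖ * ((∫ z, |χL z|) * ∫ x, |φ x|) := by
        rw [integral_const_mul, hsplit']

/-- **Monopole side.** The monopole side `∫∫ A₀(x,z) [χL(z) 𝒦†φ(x) + φ(x) G_L(z)]` of the tested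
identity equals `c (∫ χL) ∫ Sₙ 𝒦†φ` up to the term `c (∫ G_L)(∫ Sₙ φ)`, which vanishes
(`∫ G_L = 0`), and a remainder bounded by `(ε / L)(‖χL‖₁ ‖𝒦†φ‖₁ + ‖φ‖₁ ‖G_L‖₁)` once
`‖z‖ · |A₀(x,z) - c Sₙ(x)| ≤ ε` for `‖z‖ ≥ L`, `x ∈ tsupport φ`. [folklore] -/
theorem monopole_side_bound {n : ℕ} {Sn : (Fin n → EuclideanSpace ℝ (Fin 3)) → ℝ}
    {A₀ : (Fin (n + 1) → EuclideanSpace ℝ (Fin 3)) → ℝ}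
    {c ε L : ℝ} {φ Kφ : (Fin n → EuclideanSpace ℝ (Fin 3)) → ℝ}
    {χL G₁ : EuclideanSpace ℝ (Fin 3) → ℝ}
    (hSn : ContinuousOn Sn (NonCoincident 3 n))
    (hA₀ : ContinuousOn A₀ (NonCoincident 3 (n + 1)))
    (hφ : Continuous φ) (hφc : HasCompactSupport φ) (hφs : tsupport φ ⊆ NonCoincident 3 n)
    (hK : Continuous Kφ) (hKc : HasCompactSupport Kφ) (hKt : tsupport Kφ ⊆ tsupport φ)
    (hχ : Continuous χL) (hχc : HasCompactSupport χL) (hχt : tsupport χL ⊆ {z | L ≤ ‖z‖})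
    (hG : Continuous G₁) (hGc : HasCompactSupport G₁) (hGt : tsupport G₁ ⊆ {z | L ≤ ‖z‖})
    (hG0 : ∫ z, G₁ z = 0)
    (hgood : ∀ z : EuclideanSpace ℝ (Fin 3), L ≤ ‖z‖ → ∀ x ∈ tsupport φ,
      (Fin.snoc x z : Fin (n + 1) → EuclideanSpace ℝ (Fin 3)) ∈ NonCoincident 3 (n + 1))
    (hL : 0 < L) (hε : 0 ≤ ε)
    (hR : ∀ z : EuclideanSpace ℝ (Fin 3), L ≤ ‖z‖ → ∀ x ∈ tsupport φ,
      ‖‖z‖ * (A₀ (Fin.snoc x z) - c * Sn x)‖ ≤ ε) :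
    |(∫ p : EuclideanSpace ℝ (Fin 3) × (Fin n → EuclideanSpace ℝ (Fin 3)),
        A₀ (Fin.snoc p.2 p.1) * (χL p.1 * Kφ p.2 + φ p.2 * G₁ p.1))
        - c * (∫ z, χL z) * ∫ x, Sn x * Kφ x|
      ≤ ε / L * ((∫ z, |χL z|) * (∫ x, |Kφ x|) + (∫ z, |G₁ z|) * ∫ x, |φ x|) := by
  -- pointwise decomposition
  have hpt : ∀ p : EuclideanSpace ℝ (Fin 3) × (Fin n → EuclideanSpace ℝ (Fin 3)),
      A₀ (Fin.snoc p.2 p.1) * (χL p.1 * Kφ p.2 + φ p.2 * G₁ p.1)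
        = (c * (χL p.1 * (Sn p.2 * Kφ p.2)) + c * (G₁ p.1 * (Sn p.2 * φ p.2)))
          + (A₀ (Fin.snoc p.2 p.1) - c * Sn p.2) * (χL p.1 * Kφ p.2 + φ p.2 * G₁ p.1) := by
    intro p; ring
  -- the good region and the support of the weight
  have hg : Continuous fun p : EuclideanSpace ℝ (Fin 3) × (Fin n → EuclideanSpace ℝ (Fin 3)) =>
      χL p.1 * Kφ p.2 + φ p.2 * G₁ p.1 :=
    ((hχ.comp continuous_fst).mul (hK.comp continuous_snd)).add
      ((hφ.comp continuous_snd).mul (hG.comp continuous_fst))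
  have hg2 : (fun p : EuclideanSpace ℝ (Fin 3) × (Fin n → EuclideanSpace ℝ (Fin 3)) =>
      φ p.2 * G₁ p.1) = fun p => G₁ p.1 * φ p.2 := funext fun p => mul_comm _ _
  have hgc : HasCompactSupport fun p :
      EuclideanSpace ℝ (Fin 3) × (Fin n → EuclideanSpace ℝ (Fin 3)) =>
      χL p.1 * Kφ p.2 + φ p.2 * G₁ p.1 :=
    (hasCompactSupport_fst_mul_snd hχc hKc).add (hg2 ▸ hasCompactSupport_fst_mul_snd hGc hφc)
  have hWcl : IsClosed {p : EuclideanSpace ℝ (Fin 3) × (Fin n → EuclideanSpace ℝ (Fin 3)) |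
      L ≤ ‖p.1‖ ∧ p.2 ∈ tsupport φ} :=
    (isClosed_le continuous_const (continuous_norm.comp continuous_fst)).inter
      ((isClosed_tsupport φ).preimage continuous_snd)
  have hne : ∀ p : EuclideanSpace ℝ (Fin 3) × (Fin n → EuclideanSpace ℝ (Fin 3)),
      χL p.1 * Kφ p.2 + φ p.2 * G₁ p.1 ≠ 0 → L ≤ ‖p.1‖ ∧ p.2 ∈ tsupport φ := by
    intro p hp
    by_cases h1 : χL p.1 * Kφ p.2 = 0
    · rw [h1, zero_add, mul_ne_zero_iff] at hp
      exact ⟨hGt (subset_tsupport _ hp.2), subset_tsupport _ hp.1⟩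
    · have h1' := mul_ne_zero_iff.1 h1
      exact ⟨hχt (subset_tsupport _ h1'.1), hKt (subset_tsupport _ h1'.2)⟩
  have hgt : tsupport (fun p : EuclideanSpace ℝ (Fin 3) × (Fin n → EuclideanSpace ℝ (Fin 3)) =>
      χL p.1 * Kφ p.2 + φ p.2 * G₁ p.1)
        ⊆ {p | L ≤ ‖p.1‖ ∧ p.2 ∈ tsupport φ} :=
    closure_minimal (fun p hp => hne p hp) hWcl
  have hcont : ContinuousOn (fun p :
      EuclideanSpace ℝ (Fin 3) × (Fin n → EuclideanSpace ℝ (Fin 3)) =>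
      A₀ (Fin.snoc p.2 p.1)) {p | L ≤ ‖p.1‖ ∧ p.2 ∈ tsupport φ} :=
    hA₀.comp continuous_snoc_prod.continuousOn fun p hp => hgood _ hp.1 _ hp.2
  -- integrability
  have hfull : Integrable fun p : EuclideanSpace ℝ (Fin 3) × (Fin n → EuclideanSpace ℝ (Fin 3)) =>
      A₀ (Fin.snoc p.2 p.1) * (χL p.1 * Kφ p.2 + φ p.2 * G₁ p.1) :=
    integrable_mul_of_continuousOn_tsupport hg hgc (hcont.mono hgt)
  have hSK : Integrable fun x => Sn x * Kφ x :=
    integrable_mul_of_continuousOn_tsupport hK hKc (hSn.mono (hKt.trans hφs))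
  have hSφ : Integrable fun x => Sn x * φ x :=
    integrable_mul_of_continuousOn_tsupport hφ hφc (hSn.mono hφs)
  have hχi : Integrable χL := hχ.integrable_of_hasCompactSupport hχc
  have hGi : Integrable G₁ := hG.integrable_of_hasCompactSupport hGc
  have hm1 : Integrable fun p : EuclideanSpace ℝ (Fin 3) × (Fin n → EuclideanSpace ℝ (Fin 3)) =>
      c * (χL p.1 * (Sn p.2 * Kφ p.2)) := (integrable_fst_mul_snd hχi hSK).const_mul _
  have hm2 : Integrable fun p : EuclideanSpace ℝ (Fin 3) × (Fin n → EuclideanSpace ℝ (Fin 3)) =>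
      c * (G₁ p.1 * (Sn p.2 * φ p.2)) := (integrable_fst_mul_snd hGi hSφ).const_mul _
  have herr : Integrable fun p : EuclideanSpace ℝ (Fin 3) × (Fin n → EuclideanSpace ℝ (Fin 3)) =>
      (A₀ (Fin.snoc p.2 p.1) - c * Sn p.2) * (χL p.1 * Kφ p.2 + φ p.2 * G₁ p.1) := by
    have := hfull.sub (hm1.add hm2)
    refine this.congr (ae_of_all _ fun p => ?_)
    simp only [Pi.sub_apply, Pi.add_apply]
    ring
  -- pointwise bound on the remainder
  have hbd : ∀ p : EuclideanSpace ℝ (Fin 3) × (Fin n → EuclideanSpace ℝ (Fin 3)),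
      ‖(A₀ (Fin.snoc p.2 p.1) - c * Sn p.2) * (χL p.1 * Kφ p.2 + φ p.2 * G₁ p.1)‖
        ≤ ε / L * (|χL p.1| * |Kφ p.2| + |G₁ p.1| * |φ p.2|) := by
    intro p
    have hrhs : 0 ≤ ε / L * (|χL p.1| * |Kφ p.2| + |G₁ p.1| * |φ p.2|) := by positivity
    by_cases h0 : χL p.1 * Kφ p.2 + φ p.2 * G₁ p.1 = 0
    · rw [h0, mul_zero, norm_zero]
      exact hrhs
    obtain ⟨hz, hx⟩ := hne p h0
    have hzpos : 0 < ‖p.1‖ := hL.trans_le hz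
    have h1 : |A₀ (Fin.snoc p.2 p.1) - c * Sn p.2| ≤ ε / L := by
      have h2 := hR _ hz _ hx
      rw [Real.norm_eq_abs, abs_mul, abs_norm] at h2
      rw [le_div_iff₀ hL]
      calc |A₀ (Fin.snoc p.2 p.1) - c * Sn p.2| * L
          ≤ |A₀ (Fin.snoc p.2 p.1) - c * Sn p.2| * ‖p.1‖ := by gcongr
        _ = ‖p.1‖ * |A₀ (Fin.snoc p.2 p.1) - c * Sn p.2| := mul_comm _ _
        _ ≤ ε := h2
    rw [Real.norm_eq_abs, abs_mul]
    calc |A₀ (Fin.snoc p.2 p.1) - c * Sn p.2| * |χL p.1 * Kφ p.2 + φ p.2 * G₁ p.1|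
        ≤ ε / L * (|χL p.1 * Kφ p.2| + |φ p.2 * G₁ p.1|) :=
          mul_le_mul h1 (abs_add_le _ _) (abs_nonneg _) (by positivity)
      _ = ε / L * (|χL p.1| * |Kφ p.2| + |G₁ p.1| * |φ p.2|) := by
          rw [abs_mul, abs_mul, mul_comm |φ p.2|]
  have hbdi : Integrable fun p : EuclideanSpace ℝ (Fin 3) × (Fin n → EuclideanSpace ℝ (Fin 3)) =>
      ε / L * (|χL p.1| * |Kφ p.2| + |G₁ p.1| * |φ p.2|) :=
    ((integrable_fst_mul_snd hχi.abs (hK.integrable_of_hasCompactSupport hKc).abs).add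
      (integrable_fst_mul_snd hGi.abs (hφ.integrable_of_hasCompactSupport hφc).abs)).const_mul _
  -- assemble
  have hs1 : ∫ p : EuclideanSpace ℝ (Fin 3) × (Fin n → EuclideanSpace ℝ (Fin 3)),
      χL p.1 * (Sn p.2 * Kφ p.2) = (∫ z, χL z) * ∫ x, Sn x * Kφ x :=
    integral_fst_mul_snd (fun z => χL z) (fun x => Sn x * Kφ x)
  have hs2 : ∫ p : EuclideanSpace ℝ (Fin 3) × (Fin n → EuclideanSpace ℝ (Fin 3)),
      G₁ p.1 * (Sn p.2 * φ p.2) = (∫ z, G₁ z) * ∫ x, Sn x * φ x :=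
    integral_fst_mul_snd (fun z => G₁ z) (fun x => Sn x * φ x)
  have hs3 : ∫ p : EuclideanSpace ℝ (Fin 3) × (Fin n → EuclideanSpace ℝ (Fin 3)),
      |χL p.1| * |Kφ p.2| = (∫ z, |χL z|) * ∫ x, |Kφ x| :=
    integral_fst_mul_snd (fun z => |χL z|) (fun x => |Kφ x|)
  have hs4 : ∫ p : EuclideanSpace ℝ (Fin 3) × (Fin n → EuclideanSpace ℝ (Fin 3)),
      |G₁ p.1| * |φ p.2| = (∫ z, |G₁ z|) * ∫ x, |φ x| :=
    integral_fst_mul_snd (fun z => |G₁ z|) (fun x => |φ x|)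
  have hm12 : Integrable fun p : EuclideanSpace ℝ (Fin 3) × (Fin n → EuclideanSpace ℝ (Fin 3)) =>
      c * (χL p.1 * (Sn p.2 * Kφ p.2)) + c * (G₁ p.1 * (Sn p.2 * φ p.2)) := hm1.add hm2
  rw [integral_congr_ae (ae_of_all _ hpt), integral_add hm12 herr,
    integral_add hm1 hm2, integral_const_mul, integral_const_mul, hs1, hs2, hG0, zero_mul,
    mul_zero, add_zero, ← mul_assoc, add_sub_cancel_left]
  calc |∫ p : EuclideanSpace ℝ (Fin 3) × (Fin n → EuclideanSpace ℝ (Fin 3)),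
          (A₀ (Fin.snoc p.2 p.1) - c * Sn p.2) * (χL p.1 * Kφ p.2 + φ p.2 * G₁ p.1)|
      ≤ ∫ p : EuclideanSpace ℝ (Fin 3) × (Fin n → EuclideanSpace ℝ (Fin 3)),
          ε / L * (|χL p.1| * |Kφ p.2| + |G₁ p.1| * |φ p.2|) := by
        rw [← Real.norm_eq_abs]
        exact norm_integral_le_of_norm_le hbdi (ae_of_all _ hbd)
    _ = ε / L * ((∫ z, |χL z|) * (∫ x, |Kφ x|) + (∫ z, |G₁ z|) * ∫ x, |φ x|) := by
        rw [integral_const_mul, integral_add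
          (integrable_fst_mul_snd hχi.abs (hK.integrable_of_hasCompactSupport hKc).abs)
          (integrable_fst_mul_snd hGi.abs (hφ.integrable_of_hasCompactSupport hφc).abs),
          hs3, hs4]

end Summit.CriticalPhenomena.Ising3DConformalLimit.Theorems.PrimaryAtInfinityMultipoleToWard

end
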